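import Summits.Ventures.HodgeRepro2.T5TensorLatticeNonSplit
import Summits.Ventures.HodgeRepro2.T5SplitPlaceUnitaryGroup

/-!
# The tensor lattice at a split place: `𝒪_{K⁺_v} ⊗ 𝒪_K → 𝒪_w × 𝒪_{w'}` is onto (cell pub-hodge-repro2, seat p3)

Tier-5 N3 support — the split-place counterpart of file 228. At a split place (`w ≠ w'` above `v`) file 133's
`prodLift : K⁺_v ⊗ K → K_w × K_{w'}` is onto; here its restriction to the tensor lattice
`Λ = {∑ aᵢ ⊗ lᵢ : aᵢ ∈ 𝒪_{K⁺_v}}` (file 228, for `𝓞_{K⁺}`-generators `l` of `𝓞_K`) is shown to be onto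
`𝒪_w × 𝒪_{w'}`:
* `tensorLattice_add_mem` / `tensorLattice_mul_mem` / `one_tmul_mem_tensorLattice` — `Λ` is a subring containing
  `1 ⊗ 𝓞_K` (the products `lᵢ lⱼ` re-expanded on the generators);
* `image_prodLift_tensorLattice_subset` — `prodLift '' Λ ⊆ 𝒪_w × 𝒪_{w'}`;
* `isClosed_image_prodLift_tensorLattice` — `prodLift '' Λ` is compact, hence closed (the image of `𝒪_{K⁺_v}^r`);
* **`image_prodLift_tensorLattice`** — `prodLift '' Λ = 𝒪_w × 𝒪_{w'}`: given `(x, y)` integral, file 227 writes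
  `x = prodLift A`.1 and `y = prodLift B`.2 with `A, B ∈ Λ`; the Chinese-remainder elements `eₙ ≡ 1 (wⁿ)`,
  `≡ 0 (w'ⁿ)` of file 133 give `Eₙ = 1 ⊗ eₙ ∈ Λ` with `prodLift Eₙ → (1, 0)`, and
  `prodLift (Eₙ A + (1 − Eₙ) B) → (x, y)`, so `(x, y)` lies in the closed set `prodLift '' Λ`;
* **`image_splitEquiv_tensorLattice`** — through file 134's `splitEquiv : K⁺_v ⊗ K ≃+* K_w × K_w` (second
  factor transported from `K_{w'}` by the conjugation, which preserves integrality): `splitEquiv '' Λ = 𝒪_w × 𝒪_w`.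
With file 224's `splitHyperspecial` (the isometries with entries in `𝒪_w × 𝒪_w`) and file 225's
`recordSplitEquiv`, the record's `K_v` at a split place (the stabiliser of `Λ^n`) corresponds to
`U ∩ GL_n(𝒪_w × 𝒪_w)` and hence to `GL_n(𝒪_w)` — the stabiliser statement itself is left to the successor.

Mathlib + this seat's files 133 / 134 / 225 / 227 / 228 and their imports; no display; no device.
§8(d): uses an L-value-free non-vanishing device: NO.
-/

namespace Summit.Ventures.HodgeRepro2.T5TensorLatticeSplit

open Matrix NumberField NumberField.IsCMField IsDedekindDomain IsDedekindDomain.HeightOneSpectrum Module Topology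
  WithZero
open scoped TensorProduct Pointwise WithZero
open Summit.Ventures.HodgeRepro2.T5TensorLatticeNonSplit Summit.Ventures.HodgeRepro2.T5AdicCompletionIntegersSpan
  Summit.Ventures.HodgeRepro2.T5FinitePlaceSplitProduct Summit.Ventures.HodgeRepro2.T5FinitePlaceSplitClassification
  Summit.Ventures.HodgeRepro2.T5FinitePlaceGaloisTransport Summit.Ventures.HodgeRepro2.T5FinitePlaceSplitConj
  Summit.Ventures.HodgeRepro2.T5FinitePlaceCM Summit.Ventures.HodgeRepro2.T5AdicCompletionGaloisInvariance

section Ring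

variable (K : Type*) [Field K] [NumberField K]
variable (v : HeightOneSpectrum (𝓞 (maximalRealSubfield K)))
variable {r : ℕ} (l : Fin r → 𝓞 K) (hl : Submodule.span (𝓞 (maximalRealSubfield K)) (Set.range l) = ⊤)

omit [NumberField K] in
/-- `algebraMap 𝓞_K K (c • l) = (c : K⁺) · l` for `c ∈ 𝓞_{K⁺}` (the scalar towers `𝓞_{K⁺} → 𝓞_K → K` and
`𝓞_{K⁺} → K⁺ → K`). -/
theorem algebraMap_smul_eq (c : 𝓞 (maximalRealSubfield K)) (b : 𝓞 K) :
    algebraMap (𝓞 K) K (c • b) =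
      algebraMap (maximalRealSubfield K) K (algebraMap (𝓞 (maximalRealSubfield K)) (maximalRealSubfield K) c) *
        algebraMap (𝓞 K) K b := by
  rw [Algebra.smul_def, map_mul, ← IsScalarTower.algebraMap_apply,
    IsScalarTower.algebraMap_apply (𝓞 (maximalRealSubfield K)) (maximalRealSubfield K) K]

/-- `x ⊗ (r · y) = (r · x) ⊗ y` over `K⁺`. -/
theorem tmul_algebraMap_mul (x : v.adicCompletion (maximalRealSubfield K)) (r : maximalRealSubfield K) (y : K) :
    x ⊗ₜ[maximalRealSubfield K] (algebraMap (maximalRealSubfield K) K r * y) =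
      (algebraMap (maximalRealSubfield K) (v.adicCompletion (maximalRealSubfield K)) r * x) ⊗ₜ y := by
  rw [← Algebra.smul_def, ← TensorProduct.smul_tmul, Algebra.smul_def]

/-- `Λ` is closed under addition. -/
theorem tensorLattice_add_mem {z z' : (v.adicCompletion (maximalRealSubfield K)) ⊗[maximalRealSubfield K] K}
    (hz : z ∈ tensorLattice K v l) (hz' : z' ∈ tensorLattice K v l) : z + z' ∈ tensorLattice K v l := by
  obtain ⟨a, rfl⟩ := hz
  obtain ⟨b, rfl⟩ := hz'
  refine ⟨a + b, ?_⟩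
  rw [← Finset.sum_add_distrib]
  exact Finset.sum_congr rfl fun i _ => by rw [Pi.add_apply, Subring.coe_add, TensorProduct.add_tmul]

include hl in
/-- `1 ⊗ b ∈ Λ` for every `b ∈ 𝓞_K`. -/
theorem one_tmul_mem_tensorLattice (b : 𝓞 K) :
    ((1 : v.adicCompletion (maximalRealSubfield K)) ⊗ₜ[maximalRealSubfield K] algebraMap (𝓞 K) K b) ∈
      tensorLattice K v l := by
  obtain ⟨c, hc⟩ := (Submodule.mem_span_range_iff_exists_fun (𝓞 (maximalRealSubfield K))).mp
    (hl ▸ Submodule.mem_top : b ∈ _)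
  refine ⟨fun i => algebraMap (𝓞 (maximalRealSubfield K)) (v.adicCompletionIntegers (maximalRealSubfield K)) (c i),
    ?_⟩
  rw [← hc, map_sum, TensorProduct.tmul_sum]
  refine Finset.sum_congr rfl fun i _ => ?_
  rw [algebraMap_smul_eq, tmul_algebraMap_mul, mul_one]
  rfl

include hl in
/-- `Λ` is closed under multiplication (the products `lᵢ lⱼ` re-expanded on the generators). -/
theorem tensorLattice_mul_mem {z z' : (v.adicCompletion (maximalRealSubfield K)) ⊗[maximalRealSubfield K] K}
    (hz : z ∈ tensorLattice K v l) (hz' : z' ∈ tensorLattice K v l) : z * z' ∈ tensorLattice K v l := by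
  obtain ⟨a, rfl⟩ := hz
  obtain ⟨b, rfl⟩ := hz'
  rw [Finset.sum_mul_sum]
  -- each product `(aᵢ ⊗ lᵢ)(bⱼ ⊗ lⱼ) = (aᵢ bⱼ) ⊗ (lᵢ lⱼ)` lies in `Λ`
  refine Finset.sum_induction _ (· ∈ tensorLattice K v l) (fun _ _ => tensorLattice_add_mem K v l)
    ⟨0, by simp⟩ fun i _ => ?_
  refine Finset.sum_induction _ (· ∈ tensorLattice K v l) (fun _ _ => tensorLattice_add_mem K v l)
    ⟨0, by simp⟩ fun j _ => ?_
  rw [Algebra.TensorProduct.tmul_mul_tmul, ← map_mul]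
  obtain ⟨c, hc⟩ := (Submodule.mem_span_range_iff_exists_fun (𝓞 (maximalRealSubfield K))).mp
    (hl ▸ Submodule.mem_top : l i * l j ∈ _)
  refine ⟨fun k => algebraMap (𝓞 (maximalRealSubfield K)) (v.adicCompletionIntegers (maximalRealSubfield K)) (c k) *
    (a i * b j), ?_⟩
  rw [← hc, map_sum, TensorProduct.tmul_sum]
  refine Finset.sum_congr rfl fun k _ => ?_
  rw [algebraMap_smul_eq, tmul_algebraMap_mul]
  rfl

end Ring

section Split

variable (K : Type*) [Field K] [NumberField K]
variable (v : HeightOneSpectrum (𝓞 (maximalRealSubfield K))) (w w' : HeightOneSpectrum (𝓞 K))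
  [w.asIdeal.LiesOver v.asIdeal] [w'.asIdeal.LiesOver v.asIdeal]
variable {r : ℕ} (l : Fin r → 𝓞 K)

/-- `prodLift (a ⊗ x) = (a · x, a · x)` (file 115's structure maps `completionMap`). -/
theorem prodLift_tmul (a : v.adicCompletion (maximalRealSubfield K)) (x : K) :
    prodLift K v w w' (a ⊗ₜ x) =
      (T5FinitePlaceLiesOver.completionMap (maximalRealSubfield K) K v w a * algebraMap K (w.adicCompletion K) x,
        T5FinitePlaceLiesOver.completionMap (maximalRealSubfield K) K v w' a * algebraMap K (w'.adicCompletion K) x) := by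
  have h1 : a ⊗ₜ[maximalRealSubfield K] x = (a ⊗ₜ (1 : K)) * (1 ⊗ₜ x) := by
    rw [Algebra.TensorProduct.tmul_mul_tmul, mul_one, one_mul]
  rw [h1, map_mul, prodLift_tmul_one, prodLift_one_tmul, Prod.mk_mul_mk,
    T5FinitePlaceLiesOver.algebraMap_eq_completionMap, T5FinitePlaceLiesOver.algebraMap_eq_completionMap]

/-- The combination map `𝒪_{K⁺_v}^r → K_w × K_{w'}` behind `prodLift` on `Λ`. -/
noncomputable def prodComb (a : Fin r → v.adicCompletion (maximalRealSubfield K)) :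
    w.adicCompletion K × w'.adicCompletion K :=
  (∑ i, T5FinitePlaceLiesOver.completionMap (maximalRealSubfield K) K v w (a i) * intoCompletion w (l i),
    ∑ i, T5FinitePlaceLiesOver.completionMap (maximalRealSubfield K) K v w' (a i) * intoCompletion w' (l i))

/-- `prodLift` on a combination is `prodComb`. -/
theorem prodLift_sum (a : Fin r → v.adicCompletion (maximalRealSubfield K)) :
    prodLift K v w w' (∑ i, a i ⊗ₜ algebraMap (𝓞 K) K (l i)) = prodComb K v w w' l a := by
  rw [map_sum, prodComb, Prod.ext_iff]
  simp only [Prod.fst_sum, Prod.snd_sum]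
  exact ⟨Finset.sum_congr rfl fun i _ => by rw [prodLift_tmul]; rfl,
    Finset.sum_congr rfl fun i _ => by rw [prodLift_tmul]; rfl⟩

/-- `prodComb` is continuous. -/
theorem continuous_prodComb : Continuous (prodComb K v w w' l) :=
  (continuous_finsetSum _ fun i _ => ((T5FinitePlaceLiesOver.continuous_completionMap (maximalRealSubfield K) K v w).comp
      (continuous_apply i)).mul continuous_const).prodMk
    (continuous_finsetSum _ fun i _ => ((T5FinitePlaceLiesOver.continuous_completionMap (maximalRealSubfield K) K v w').comp
      (continuous_apply i)).mul continuous_const)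

/-- A combination with integral coefficients is integral in both factors. -/
theorem prodComb_mem {a : Fin r → v.adicCompletion (maximalRealSubfield K)}
    (ha : ∀ i, a i ∈ v.adicCompletionIntegers (maximalRealSubfield K)) :
    (prodComb K v w w' l a).1 ∈ w.adicCompletionIntegers K ∧
      (prodComb K v w w' l a).2 ∈ w'.adicCompletionIntegers K :=
  ⟨Subring.sum_mem _ fun i _ => Subring.mul_mem _ (T5FinitePlaceLiesOver.completionMap_mem_adicCompletionIntegers _ _ v w (ha i))
      (intoCompletion_mem w (l i)),
    Subring.sum_mem _ fun i _ => Subring.mul_mem _ (T5FinitePlaceLiesOver.completionMap_mem_adicCompletionIntegers _ _ v w' (ha i))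
      (intoCompletion_mem w' (l i))⟩

/-- `prodLift '' Λ` is the image of `𝒪_{K⁺_v}^r` under `prodComb`. -/
theorem image_prodLift_tensorLattice_eq :
    prodLift K v w w' '' tensorLattice K v l =
      prodComb K v w w' l '' Set.univ.pi fun _ =>
        (v.adicCompletionIntegers (maximalRealSubfield K) : Set (v.adicCompletion (maximalRealSubfield K))) := by
  ext p
  constructor
  · rintro ⟨z, ⟨a, rfl⟩, rfl⟩
    exact ⟨fun i => a i, fun i _ => (a i).2, (prodLift_sum K v w w' l _).symm⟩
  · rintro ⟨a, ha, rfl⟩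
    exact ⟨∑ i, a i ⊗ₜ algebraMap (𝓞 K) K (l i), ⟨fun i => ⟨a i, ha i (Set.mem_univ i)⟩, rfl⟩,
      prodLift_sum K v w w' l a⟩

/-- `prodLift '' Λ` is closed (compact: the continuous image of `𝒪_{K⁺_v}^r`). -/
theorem isClosed_image_prodLift_tensorLattice : IsClosed (prodLift K v w w' '' tensorLattice K v l) := by
  rw [image_prodLift_tensorLattice_eq]
  exact ((isCompact_univ_pi fun _ => isCompact_adicCompletionIntegers v).image
    (continuous_prodComb K v w w' l)).isClosed

/-- `prodLift '' Λ ⊆ 𝒪_w × 𝒪_{w'}`. -/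
theorem image_prodLift_tensorLattice_subset :
    prodLift K v w w' '' tensorLattice K v l ⊆
      (w.adicCompletionIntegers K : Set (w.adicCompletion K)) ×ˢ
        (w'.adicCompletionIntegers K : Set (w'.adicCompletion K)) := by
  rintro _ ⟨z, ⟨a, rfl⟩, rfl⟩
  rw [prodLift_sum]
  exact prodComb_mem K v w w' l fun i => (a i).2

/-- `1 − 1 ⊗ e = 1 ⊗ (1 − e)`. -/
theorem one_sub_one_tmul (e : 𝓞 K) :
    (1 : (v.adicCompletion (maximalRealSubfield K)) ⊗[maximalRealSubfield K] K) -
        (1 : v.adicCompletion (maximalRealSubfield K)) ⊗ₜ algebraMap (𝓞 K) K e =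
      (1 : v.adicCompletion (maximalRealSubfield K)) ⊗ₜ algebraMap (𝓞 K) K (1 - e) := by
  rw [map_sub, map_one, TensorProduct.tmul_sub, Algebra.TensorProduct.one_def]

/-- `(prodLift A).1 = x` for the combination `A` of file 227 at `w`. -/
theorem prodLift_fst_eq (a : Fin r → v.adicCompletionIntegers (maximalRealSubfield K)) :
    (prodLift K v w w' (∑ i, ((a i : v.adicCompletion (maximalRealSubfield K)) ⊗ₜ algebraMap (𝓞 K) K (l i)))).1 =
      ∑ i, ((a i : v.adicCompletion (maximalRealSubfield K)) • intoCompletion w (l i)) := by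
  rw [prodLift_sum, prodComb]
  dsimp only
  exact Finset.sum_congr rfl fun i _ => by rw [Algebra.smul_def, T5FinitePlaceNormIndex.algebraMap_apply']

/-- `(prodLift B).2 = y` for the combination `B` of file 227 at `w'`. -/
theorem prodLift_snd_eq (b : Fin r → v.adicCompletionIntegers (maximalRealSubfield K)) :
    (prodLift K v w w' (∑ i, ((b i : v.adicCompletion (maximalRealSubfield K)) ⊗ₜ algebraMap (𝓞 K) K (l i)))).2 =
      ∑ i, ((b i : v.adicCompletion (maximalRealSubfield K)) • intoCompletion w' (l i)) := by
  rw [prodLift_sum, prodComb]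
  dsimp only
  exact Finset.sum_congr rfl fun i _ => by rw [Algebra.smul_def, T5FinitePlaceNormIndex.algebraMap_apply']

/-- **`𝒪_{K⁺_v} ⊗ 𝒪_K → 𝒪_w × 𝒪_{w'}` IS ONTO AT A SPLIT PLACE**: `prodLift '' Λ = 𝒪_w × 𝒪_{w'}` for
`w ≠ w'` above `v` and `𝓞_{K⁺}`-generators `l` of `𝓞_K` — the closed set `prodLift '' Λ` contains
`prodLift (Eₙ A + (1 − Eₙ) B) → (x, y)` with `Eₙ = 1 ⊗ eₙ` the Chinese-remainder elements of file 133. -/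
theorem image_prodLift_tensorLattice (hne : w ≠ w')
    (hl : Submodule.span (𝓞 (maximalRealSubfield K)) (Set.range l) = ⊤) :
    prodLift K v w w' '' tensorLattice K v l =
      (w.adicCompletionIntegers K : Set (w.adicCompletion K)) ×ˢ
        (w'.adicCompletionIntegers K : Set (w'.adicCompletion K)) := by
  refine Set.Subset.antisymm (image_prodLift_tensorLattice_subset K v w w' l) ?_
  rintro ⟨x, y⟩ ⟨hx, hy⟩
  rw [← (isClosed_image_prodLift_tensorLattice K v w w' l).closure_eq, mem_closure_iff_nhds]
  intro U hU
  -- `A, B ∈ Λ` with `(prodLift A).1 = x` and `(prodLift B).2 = y` (file 227)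
  obtain ⟨A, hAmem, hA1⟩ : ∃ A ∈ tensorLattice K v l, (prodLift K v w w' A).1 = x := by
    obtain ⟨a, hxa⟩ := exists_sum_smul_eq_of_mem_integers v w l hl hx
    exact ⟨_, ⟨a, rfl⟩, by rw [prodLift_fst_eq]; exact hxa.symm⟩
  obtain ⟨B, hBmem, hB2⟩ : ∃ B ∈ tensorLattice K v l, (prodLift K v w w' B).2 = y := by
    obtain ⟨b, hyb⟩ := exists_sum_smul_eq_of_mem_integers v w' l hl hy
    exact ⟨_, ⟨b, rfl⟩, by rw [prodLift_snd_eq]; exact hyb.symm⟩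
  -- the continuous map `p ↦ p · prodLift A + (1 − p) · prodLift B` sends `(1, 0)` to `(x, y)`
  obtain ⟨pA, hpA⟩ : ∃ pA, prodLift K v w w' A = pA := ⟨_, rfl⟩
  obtain ⟨pB, hpB⟩ : ∃ pB, prodLift K v w w' B = pB := ⟨_, rfl⟩
  rw [hpA] at hA1
  rw [hpB] at hB2
  let Φ : w.adicCompletion K × w'.adicCompletion K → w.adicCompletion K × w'.adicCompletion K :=
    fun p => p * pA + (1 - p) * pB
  have hΦc : Continuous Φ :=
    (continuous_id.mul continuous_const).add ((continuous_const.sub continuous_id).mul continuous_const)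
  have hΦ10 : Φ ((1 : w.adicCompletion K), (0 : w'.adicCompletion K)) = (x, y) := by
    refine Prod.ext ?_ ?_
    · change (1 : w.adicCompletion K) * pA.1 + (1 - 1) * pB.1 = x
      rw [one_mul, sub_self, zero_mul, add_zero, hA1]
    · change (0 : w'.adicCompletion K) * pA.2 + (1 - 0) * pB.2 = y
      rw [zero_mul, sub_zero, one_mul, zero_add, hB2]
  have hV : Φ ⁻¹' U ∈ 𝓝 ((1 : w.adicCompletion K), (0 : w'.adicCompletion K)) :=
    hΦc.continuousAt.preimage_mem_nhds (hΦ10 ▸ hU)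
  obtain ⟨U₁, hU₁, U₂, hU₂, hsub⟩ := mem_nhds_prod_iff.mp hV
  obtain ⟨n₁, hn₁⟩ := exists_exp_neg_lt_of_mem_nhds hU₁
  obtain ⟨n₂, hn₂⟩ := exists_exp_neg_lt_of_mem_nhds hU₂
  obtain ⟨e, he1, he2⟩ := exists_crt w w' hne (max n₁ n₂)
  -- `E = 1 ⊗ e`, `prodLift E ∈ U₁ ×ˢ U₂`, and `Φ (prodLift E) = prodLift (E A + (1 − E) B)`
  have hE : prodLift K v w w' ((1 : v.adicCompletion (maximalRealSubfield K)) ⊗ₜ algebraMap (𝓞 K) K e) ∈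
      U₁ ×ˢ U₂ := by
    rw [prodLift_one_tmul]
    refine ⟨hn₁ _ ?_, hn₂ _ ?_⟩
    · refine (valued_algebraMap_sub_one_le K w he1).trans (exp_le_exp.mpr ?_)
      have := le_max_left n₁ n₂
      omega
    · rw [sub_zero]
      refine (valued_algebraMap_le K w' he2).trans (exp_le_exp.mpr ?_)
      have := le_max_right n₁ n₂
      omega
  refine ⟨Φ (prodLift K v w w' ((1 : v.adicCompletion (maximalRealSubfield K)) ⊗ₜ algebraMap (𝓞 K) K e)),
    hsub hE, ?_⟩
  refine ⟨((1 : v.adicCompletion (maximalRealSubfield K)) ⊗ₜ algebraMap (𝓞 K) K e) * A +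
    (1 - (1 : v.adicCompletion (maximalRealSubfield K)) ⊗ₜ algebraMap (𝓞 K) K e) * B, ?_, ?_⟩
  · refine tensorLattice_add_mem K v l (tensorLattice_mul_mem K v l hl (one_tmul_mem_tensorLattice K v l hl e) hAmem)
      (tensorLattice_mul_mem K v l hl ?_ hBmem)
    rw [one_sub_one_tmul]
    exact one_tmul_mem_tensorLattice K v l hl (1 - e)
  · rw [map_add, map_mul, map_mul, map_sub, map_one, hpA, hpB]

end Split

/-! ## Through `splitEquiv`: the second factor transported by the conjugation -/

section Transport

variable (K : Type*) [Field K] [NumberField K] [IsCMField K]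
variable (w w' : HeightOneSpectrum (𝓞 K)) (hw : complexConj K • w.asIdeal = w'.asIdeal)

/-- The transport `K_w → K_{w'}` by the conjugation sends `𝓞_K` to `𝓞_K` (Mathlib's `ringOfIntegersComplexConj`). -/
theorem transport_intoCompletion (a : 𝓞 K) :
    transport w w' (complexConj K) hw (intoCompletion w a) = intoCompletion w' (ringOfIntegersComplexConj K a) :=
  transport_coe w w' (complexConj K) hw (algebraMap (𝓞 K) K a)

include hw in
/-- **The transport by the conjugation preserves integrality**: `𝒪_w → 𝒪_{w'}` (the closure of `𝓞_K`, file 227,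
under a continuous map into the closed `𝒪_{w'}`). -/
theorem transport_mem_integers {z : w.adicCompletion K} (hz : z ∈ w.adicCompletionIntegers K) :
    transport w w' (complexConj K) hw z ∈ w'.adicCompletionIntegers K := by
  have h1 : transport w w' (complexConj K) hw z ∈
      closure (transport w w' (complexConj K) hw '' Set.range (intoCompletion w)) :=
    image_closure_subset_closure_image (continuous_transport w w' (complexConj K) hw)
      ⟨z, mem_closure_range_of_mem_integers w hz, rfl⟩
  refine closure_minimal ?_ (isCompact_adicCompletionIntegers w').isClosed h1
  rintro _ ⟨_, ⟨a, rfl⟩, rfl⟩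
  rw [transport_intoCompletion]
  exact intoCompletion_mem w' _

include hw in
/-- `transport '' 𝒪_{w'} = 𝒪_w` for the transport `K_{w'} → K_w` by the conjugation. -/
theorem image_transport_integers :
    transport w' w (complexConj K) (complexConj_smul_eq K w w' hw) ''
        (w'.adicCompletionIntegers K : Set (w'.adicCompletion K)) =
      (w.adicCompletionIntegers K : Set (w.adicCompletion K)) := by
  ext y
  constructor
  · rintro ⟨z, hz, rfl⟩
    exact transport_mem_integers K w' w (complexConj_smul_eq K w w' hw) hz
  · intro hy
    refine ⟨transport w w' (complexConj K) hw y, transport_mem_integers K w w' hw hy, ?_⟩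
    exact transport_conj_transport_conj K w w' hw y

variable (v : HeightOneSpectrum (𝓞 (maximalRealSubfield K))) [w.asIdeal.LiesOver v.asIdeal]
  [w'.asIdeal.LiesOver v.asIdeal]
variable {θ : maximalRealSubfield K} {y : K}
  (hθ : algebraMap (maximalRealSubfield K) K θ = y ^ 2) (hy : complexConj K y ≠ y) (hne : w ≠ w')
  (hsq : IsSquare (algebraMap (maximalRealSubfield K) (v.adicCompletion (maximalRealSubfield K)) θ))
variable {r : ℕ} (l : Fin r → 𝓞 K)

/-- `splitEquiv` is `prodLift` followed by the transport of the second factor. -/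
theorem splitEquiv_eq_comp :
    ⇑(splitEquiv K v w w' hw hθ hy hne hsq) =
      (fun p : w.adicCompletion K × w'.adicCompletion K =>
        (p.1, transport w' w (complexConj K) (complexConj_smul_eq K w w' hw) p.2)) ∘ prodLift K v w w' :=
  funext fun z => splitEquiv_apply K v w w' hw hθ hy hne hsq z

/-- **`𝒪_{K⁺_v} ⊗ 𝒪_K → 𝒪_w × 𝒪_w` IS ONTO THROUGH `splitEquiv`**: `splitEquiv '' Λ = 𝒪_w × 𝒪_w`. -/
theorem image_splitEquiv_tensorLattice (hl : Submodule.span (𝓞 (maximalRealSubfield K)) (Set.range l) = ⊤) :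
    splitEquiv K v w w' hw hθ hy hne hsq '' tensorLattice K v l =
      (w.adicCompletionIntegers K : Set (w.adicCompletion K)) ×ˢ
        (w.adicCompletionIntegers K : Set (w.adicCompletion K)) := by
  rw [splitEquiv_eq_comp, Set.image_comp, image_prodLift_tensorLattice K v w w' l hne hl,
    ← image_transport_integers K w w' hw]
  ext ⟨p, q⟩
  constructor
  · rintro ⟨⟨p', q'⟩, ⟨hp, hq⟩, h⟩
    simp only [Prod.mk.injEq] at h
    obtain ⟨rfl, rfl⟩ := h
    exact ⟨hp, q', hq, rfl⟩
  · rintro ⟨hp, q', hq, rfl⟩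
    exact ⟨(p, q'), ⟨hp, hq⟩, rfl⟩

end Transport

end Summit.Ventures.HodgeRepro2.T5TensorLatticeSplit
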